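import Literature.Computability.ImplicitComplexity.STARenaming
import Literature.Computability.ImplicitComplexity.STATypeSubst
import Literature.Computability.ImplicitComplexity.STAConfluence
import HarnessLib

/-!
# Typed combinators for `STA` programs, I: applications, abstractions, finite data

Support file for the `PTIME` COMPLETENESS half of `STACapturesP` (GMR08 Thm. 3.9: "A decision
problem decidable by a DTM in polynomial time is λ-definable by a term typable in STA"). The
proof programs a Turing-machine simulator in the typed λ-calculus; this file starts the toolkit
of typed building blocks, each coming with (i) its typing, in the form
`HT r Γ M σ` = "`Γ ⊢ M : σ` is derivable in `STA` with multiplexor ranks `≤ r`" (a thin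
existential wrapper around the weighted derivations `MTyping` of `STAWeighted.lean`, so that the
renaming / weakening / type-substitution lemmas proved there are available), and (ii) its
β-behaviour as a `Reduces` statement:

* de Bruijn spines `Term.apps M [N₁,…,Nₙ]`, `Term.lams n M`, arrow types `LinTy.arrows`;
* `HT` and its rule-level constructors (`HT.var`, `HT.lam`, `HT.app`, `HT.sp`, `HT.allI`,
  `HT.allE`, `HT.extend`, `HT.ofClosed`, …), `HT.typing` (back to `STA.Typing`);
* the finite types `E_n ≐ ∀α. α ⊸ ⋯ ⊸ α ⊸ α` (`tyE n`; `tyB = tyE 2`) with their canonical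
  inhabitants `oneHot n i ≐ λx₀…xₙ₋₁.xᵢ` (degree `0`, GMR08 §3.2 "booleans … `0 ≐ λxy.x`"),
  CASE ANALYSIS `e F₀ ⋯ Fₙ₋₁` on closed branches (`HT.caseE`) and its reduction
  `oneHot n i F₀ ⋯ Fₙ₋₁ →* Fᵢ` (`reduces_apps_oneHot`).

## References

* [GaboardiMarionRonchidellarocca2008] GMR08, §3.2 (data types, booleans, "if x then M else N
  ≐ xMN", definability Def. 3.8), Thm. 3.9.
* [GaboardiRonchiDellaRocca2007] GR07, §5 (PTIME completeness of STA).
-/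

namespace Literature.Computability.ImplicitComplexity

namespace STA

/-! ### Spines -/

/-- Iterated application `M N₁ ⋯ Nₙ`. [folklore] -/
def Term.apps : Term → List Term → Term
  | M, [] => M
  | M, N :: Ns => Term.apps (.app M N) Ns

/-- Iterated abstraction `λx₁…xₙ.M`. [folklore] -/
def Term.lams : ℕ → Term → Term
  | 0, M => M
  | n + 1, M => .lam (Term.lams n M)

/-- Iterated arrow `σ₁ ⊸ ⋯ ⊸ σₙ ⊸ A`. [folklore] -/
def LinTy.arrows : List SoftTy → LinTy → LinTy
  | [], A => A
  | σ :: σs, A => .limp σ.bangs σ.lin (LinTy.arrows σs A)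

/-- `apps_nil` (bookkeeping). [folklore] -/
@[simp] theorem Term.apps_nil (M : Term) : M.apps [] = M := rfl
/-- `apps_cons` (bookkeeping). [folklore] -/
@[simp] theorem Term.apps_cons (M N : Term) (Ns : List Term) : M.apps (N :: Ns) = (Term.app M N).apps Ns := rfl

/-- `apps` after `apps`. [folklore] -/
theorem Term.apps_append (M : Term) (Ns Ps : List Term) : M.apps (Ns ++ Ps) = (M.apps Ns).apps Ps := by
  induction Ns generalizing M with
  | nil => rfl
  | cons N Ns ih => exact ih _

/-- Reduction in the head of a spine. [folklore] -/
theorem Reduces.apps {M M' : Term} (h : Reduces M M') (Ns : List Term) : Reduces (M.apps Ns) (M'.apps Ns) := by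
  induction Ns generalizing M M' with
  | nil => exact h
  | cons N Ns ih => exact ih (h.appL N)

/-- Renaming a spine. [folklore] -/
theorem Term.rename_apps (M : Term) (Ns : List Term) (ρ : ℕ → ℕ) :
    (M.apps Ns).rename ρ = (M.rename ρ).apps (Ns.map fun N => N.rename ρ) := by
  induction Ns generalizing M with
  | nil => rfl
  | cons N Ns ih => simp [Term.apps, ih, Term.rename]

/-- Substituting in a spine. [folklore] -/
theorem Term.substp_apps (M : Term) (Ns : List Term) (τ : ℕ → Term) :
    (M.apps Ns).substp τ = (M.substp τ).apps (Ns.map fun N => N.substp τ) := by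
  induction Ns generalizing M with
  | nil => rfl
  | cons N Ns ih => simp [Term.apps, ih, Term.substp]

/-- Substituting in an iterated abstraction. [folklore] -/
theorem Term.substp_lams (n : ℕ) (M : Term) (τ : ℕ → Term) :
    (Term.lams n M).substp τ = Term.lams n (M.substp (Term.up^[n] τ)) := by
  induction n generalizing τ with
  | zero => rfl
  | succ n ih =>
    simp only [Term.lams, Term.substp, ih]
    rw [Function.iterate_succ_apply]

/-- Renaming an iterated abstraction. [folklore] -/
theorem Term.rename_lams (n : ℕ) (M : Term) (ρ : ℕ → ℕ) :
    (Term.lams n M).rename ρ = Term.lams n (M.rename (liftRen^[n] ρ)) := by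
  induction n generalizing ρ with
  | zero => rfl
  | succ n ih =>
    simp only [Term.lams, Term.rename, ih]
    rw [Function.iterate_succ_apply]

/-- Sum-freeness of spines. [folklore] -/
theorem Term.SumFree.apps {M : Term} (hM : M.SumFree) {Ns : List Term} (hNs : ∀ N ∈ Ns, N.SumFree) :
    (M.apps Ns).SumFree := by
  induction Ns generalizing M with
  | nil => exact hM
  | cons N Ns ih =>
    exact ih ⟨hM, hNs N (by simp)⟩ fun P hP => hNs P (by simp [hP])

/-- Sum-freeness of iterated abstractions. [folklore] -/
theorem Term.SumFree.lams {M : Term} (hM : M.SumFree) (n : ℕ) : (Term.lams n M).SumFree := by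
  induction n with
  | zero => exact hM
  | succ n ih => exact ih

/-! ### `HT`: derivability with bounded ranks -/

/-- `HT r Γ M σ`: `Γ ⊢ M : σ` is derivable in `STA` by a derivation whose multiplexors have rank
`≤ r` (some degree, some weight). [cite: GaboardiMarionRonchidellarocca2008, Table 2] -/
def HT (r : ℕ) (Γ : Ctx) (M : Term) (σ : SoftTy) : Prop := ∃ d w, MTyping r w d Γ M σ

namespace HT

variable {r : ℕ}

/-- Back to `STA.Typing` (with the degree of the derivation). [cite: GaboardiMarionRonchidellarocca2008, Table 2] -/
theorem typing {Γ : Ctx} {M : Term} {σ : SoftTy} (h : HT r Γ M σ) : ∃ d, Typing d Γ M σ := by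
  obtain ⟨d, w, h⟩ := h
  exact ⟨d, h.typing⟩

/-- The subject is sum-free. [folklore] -/
theorem sumFree {Γ : Ctx} {M : Term} {σ : SoftTy} (h : HT r Γ M σ) : M.SumFree := by
  obtain ⟨d, w, h⟩ := h
  exact h.sumFree

/-- Free variables are declared. [folklore] -/
theorem isSome_of_freeIn {Γ : Ctx} {M : Term} {σ : SoftTy} (h : HT r Γ M σ) {i : ℕ} (hi : M.FreeIn i) :
    Γ i ≠ none := by
  obtain ⟨d, w, h⟩ := h
  exact h.isSome_of_freeIn hi

/-- A term typed in the empty context is closed. [folklore] -/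
theorem closed {M : Term} {σ : SoftTy} (h : HT r Ctx.empty M σ) (i : ℕ) : ¬M.FreeIn i :=
  fun hi => h.isSome_of_freeIn hi rfl

/-- Rule `(Ax)`. [cite: GaboardiMarionRonchidellarocca2008, Table 2 (Ax)] -/
theorem var {Γ : Ctx} {i : ℕ} {A : LinTy} (h : Γ.IsSingleton i ⟨0, A⟩) : HT r Γ (.var i) ⟨0, A⟩ :=
  ⟨0, 1, MTyping.ax h⟩

/-- Rule `(⊸I)`. [cite: GaboardiMarionRonchidellarocca2008, Table 2 (⊸I)] -/
theorem lam {Γ : Ctx} {M : Term} {σ : SoftTy} {A : LinTy} (h : HT r (Ctx.cons (some σ) Γ) M ⟨0, A⟩) :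
    HT r Γ (.lam M) ⟨0, .limp σ.bangs σ.lin A⟩ := by
  obtain ⟨d, w, h⟩ := h
  exact ⟨d, w + 1, MTyping.lam h⟩

/-- Rule `(⊸E)`. [cite: GaboardiMarionRonchidellarocca2008, Table 2 (⊸E)] -/
theorem app {Γ Γ₁ Γ₂ : Ctx} {M N : Term} {k : ℕ} {B A : LinTy} (hs : Γ.Split Γ₁ Γ₂)
    (h₁ : HT r Γ₁ M ⟨0, .limp k B A⟩) (h₂ : HT r Γ₂ N ⟨k, B⟩) : HT r Γ (.app M N) ⟨0, A⟩ := by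
  obtain ⟨d₁, w₁, h₁⟩ := h₁
  obtain ⟨d₂, w₂, h₂⟩ := h₂
  exact ⟨_, _, MTyping.app hs h₁ h₂⟩

/-- Rule `(sp)`. [cite: GaboardiMarionRonchidellarocca2008, Table 2 (sp)] -/
theorem sp {Γ : Ctx} {M : Term} {k : ℕ} {A : LinTy} (h : HT r Γ M ⟨k, A⟩) : HT r Γ.bang M ⟨k + 1, A⟩ := by
  obtain ⟨d, w, h⟩ := h
  exact ⟨d + 1, r * w, MTyping.sp h rfl⟩

/-- Iterated `(sp)`. [cite: GaboardiMarionRonchidellarocca2008, Table 2 (sp)] -/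
theorem spN {Γ : Ctx} {M : Term} {k : ℕ} {A : LinTy} (h : HT r Γ M ⟨k, A⟩) (hΓ : Γ.bang = Γ) (n : ℕ) :
    HT r Γ M ⟨k + n, A⟩ := by
  induction n with
  | zero => exact h
  | succ n ih =>
    have := ih.sp
    rw [hΓ] at this
    exact this

/-- Rule `(m)`. [cite: GaboardiMarionRonchidellarocca2008, Table 2 (m)] -/
theorem mpx {Γ : Ctx} {M : Term} {μ σ : SoftTy} (S : Finset ℕ) (j : ℕ) (h : HT r Γ M μ)
    (hS : ∀ i ∈ S, Γ i = some σ) (hj : Γ j = none) (hr : S.card ≤ r) :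
    HT r (Γ.mpx S j σ) (M.rename (mpxRen S j)) μ := by
  obtain ⟨d, w, h⟩ := h
  exact ⟨d, w, MTyping.mpx S j h hS hj hr rfl rfl⟩

/-- Rule `(∀I)`. [cite: GaboardiMarionRonchidellarocca2008, Table 2 (∀I)] -/
theorem allI {Γ : Ctx} {M : Term} {A : LinTy} (h : HT r Γ.shift M ⟨0, A⟩) : HT r Γ M ⟨0, .all A⟩ := by
  obtain ⟨d, w, h⟩ := h
  exact ⟨d, w, MTyping.allI h rfl⟩

/-- Rule `(∀E)`. [cite: GaboardiMarionRonchidellarocca2008, Table 2 (∀E)] -/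
theorem allE {Γ : Ctx} {M : Term} {B : LinTy} (A : LinTy) (h : HT r Γ M ⟨0, .all B⟩) : HT r Γ M ⟨0, B.inst A⟩ := by
  obtain ⟨d, w, h⟩ := h
  exact ⟨d, w, MTyping.allE A h⟩

/-- Admissible weakening: any finite extension of the context. [cite: GaboardiMarionRonchidellarocca2008, Table 2 (w), (m)] -/
theorem extend {Γ Γ' : Ctx} {M : Term} {σ : SoftTy} (h : HT r Γ M σ) (hle : ∀ i, Γ i ≠ none → Γ' i = Γ i)
    {n : ℕ} (hb : Γ'.BoundedBy n) : HT r Γ' M σ := by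
  obtain ⟨d, w, h⟩ := h
  exact ⟨d, w, h.extend hle hb⟩

/-- A closed term can be used in any finite context. [folklore] -/
theorem ofClosed {Γ : Ctx} {M : Term} {σ : SoftTy} (h : HT r Ctx.empty M σ) {n : ℕ} (hb : Γ.BoundedBy n) : HT r Γ M σ :=
  h.extend (fun _ hi => absurd rfl hi) hb

/-- Renaming along an injective-on-support map. [folklore] -/
theorem rename_ctx {Γ : Ctx} {M : Term} {σ : SoftTy} (h : HT r Γ M σ) {ρ : ℕ → ℕ} (hρ : Γ.InjOn ρ) :
    HT r (Γ.image ρ) (M.rename ρ) σ := by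
  obtain ⟨d, w, h⟩ := h
  exact ⟨d, w, h.rename_ctx hρ⟩

/-- Carrying a term under a new binder. [folklore] -/
theorem shift_succ {Γ : Ctx} {M : Term} {σ : SoftTy} (h : HT r Γ M σ) : HT r (Ctx.cons none Γ) (M.rename Nat.succ) σ := by
  obtain ⟨d, w, h⟩ := h
  exact ⟨d, w, h.shift_succ⟩

/-- Type substitution. [folklore] -/
theorem substT {Γ : Ctx} {M : Term} {σ : SoftTy} (h : HT r Γ M σ) (θ : ℕ → LinTy) :
    HT r (Γ.substT θ) M (σ.substT θ) := by
  obtain ⟨d, w, h⟩ := h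
  exact ⟨d, w, h.substT θ⟩

/-- Raising the rank bound. [folklore] -/
theorem mono_rank {Γ : Ctx} {M : Term} {σ : SoftTy} (h : HT r Γ M σ) {r' : ℕ} (hr : r ≤ r') : HT r' Γ M σ := by
  obtain ⟨d, w, h⟩ := h
  obtain ⟨w', -, h'⟩ := h.mono_rank hr
  exact ⟨d, w', h'⟩

/-- Closed function applied to an argument. [folklore] -/
theorem app_fun_closed {Γ : Ctx} {M N : Term} {k : ℕ} {B A : LinTy} (h₁ : HT r Ctx.empty M ⟨0, .limp k B A⟩)
    (h₂ : HT r Γ N ⟨k, B⟩) : HT r Γ (.app M N) ⟨0, A⟩ :=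
  app (Γ₁ := Ctx.empty) (fun _ => Or.inr ⟨rfl, rfl⟩) h₁ h₂

/-- Function applied to a closed argument. [folklore] -/
theorem app_arg_closed {Γ : Ctx} {M N : Term} {k : ℕ} {B A : LinTy} (h₁ : HT r Γ M ⟨0, .limp k B A⟩)
    (h₂ : HT r Ctx.empty N ⟨k, B⟩) : HT r Γ (.app M N) ⟨0, A⟩ :=
  app (Γ₂ := Ctx.empty) (fun _ => Or.inl ⟨rfl, rfl⟩) h₁ h₂

/-- A spine of closed arguments. [folklore] -/
theorem apps_closed {Γ : Ctx} {M : Term} {σs : List SoftTy} {A : LinTy} {Ns : List Term}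
    (h : HT r Γ M ⟨0, LinTy.arrows σs A⟩) (hlen : Ns.length = σs.length)
    (hNs : ∀ i (hi : i < Ns.length), HT r Ctx.empty (Ns.get ⟨i, hi⟩) (σs.get ⟨i, hlen ▸ hi⟩)) :
    HT r Γ (M.apps Ns) ⟨0, A⟩ := by
  induction σs generalizing M Ns with
  | nil =>
    cases Ns with
    | nil => exact h
    | cons _ _ => simp at hlen
  | cons σ σs ih =>
    cases Ns with
    | nil => simp at hlen
    | cons N Ns =>
      simp only [List.length_cons, Nat.add_right_cancel_iff] at hlen
      have h0 := hNs 0 (by simp)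
      simp only [List.get_eq_getElem, List.getElem_cons_zero] at h0
      rw [Term.apps_cons]
      refine ih (h.app_arg_closed (k := σ.bangs) (B := σ.lin) h0) hlen fun i hi => ?_
      have := hNs (i + 1) (by simp only [List.length_cons]; omega)
      simpa using this

end HT

/-! ### The empty context and small contexts -/

/-- The empty context is its own promotion. [folklore] -/
@[simp] theorem Ctx.bang_empty : Ctx.empty.bang = Ctx.empty := rfl

/-- The empty context is its own type shift. [folklore] -/
@[simp] theorem Ctx.shift_empty : Ctx.empty.shift = Ctx.empty := rfl

/-- `cons a Γ` has support bounded by `n + 1`. [folklore] -/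
theorem Ctx.BoundedBy.cons {Γ : Ctx} {n : ℕ} (h : Γ.BoundedBy n) (a : Option SoftTy) :
    (Ctx.cons a Γ).BoundedBy (n + 1) := fun i hi => by
  cases i with
  | zero => omega
  | succ i => exact h i (by omega)

/-- The context `x_{n-1} : τ, …, x₀ : τ` of `n` binders of the same type over `Γ`. [folklore] -/
def Ctx.consN (n : ℕ) (τ : SoftTy) (Γ : Ctx) : Ctx := fun i => if i < n then some τ else Γ (i - n)

/-- `consN_zero` (bookkeeping). [folklore] -/
@[simp] theorem Ctx.consN_zero (τ : SoftTy) (Γ : Ctx) : Ctx.consN 0 τ Γ = Γ := by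
  funext i; simp [Ctx.consN]

/-- `consN (n+1) = cons ∘ consN n`. [folklore] -/
theorem Ctx.consN_succ (n : ℕ) (τ : SoftTy) (Γ : Ctx) : Ctx.consN (n + 1) τ Γ = Ctx.cons (some τ) (Ctx.consN n τ Γ) := by
  funext i
  cases i with
  | zero => simp [Ctx.consN, Ctx.cons]
  | succ i =>
    simp only [Ctx.consN, Ctx.cons]
    by_cases h : i < n
    · simp [h, show i + 1 < n + 1 by omega]
    · simp [h, show ¬(i + 1 < n + 1) by omega, Nat.succ_sub_succ]

/-- `consN (n+1) τ Γ = consN n τ (cons τ Γ)` (the outermost binder is the deepest slot). [folklore] -/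
theorem Ctx.consN_succ' (n : ℕ) (τ : SoftTy) (Γ : Ctx) : Ctx.consN (n + 1) τ Γ = Ctx.consN n τ (Ctx.cons (some τ) Γ) := by
  funext i
  simp only [Ctx.consN]
  by_cases h : i < n
  · simp [h, show i < n + 1 by omega]
  · by_cases h' : i = n
    · subst h'; simp [Ctx.cons]
    · have h1 : ¬(i < n + 1) := by omega
      simp only [h, h1, if_false]
      obtain ⟨k, rfl⟩ : ∃ k, i = n + 1 + k := ⟨i - (n + 1), by omega⟩
      simp [Ctx.cons, show n + 1 + k - n = k + 1 by omega, show n + 1 + k - (n + 1) = k by omega]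

/-- `n` abstractions of the same linear-or-modal type. [cite: GaboardiMarionRonchidellarocca2008, Table 2 (⊸I)] -/
theorem HT.lams {r : ℕ} {Γ : Ctx} {M : Term} {τ : SoftTy} {A : LinTy} (n : ℕ)
    (h : HT r (Ctx.consN n τ Γ) M ⟨0, A⟩) :
    HT r Γ (Term.lams n M) ⟨0, LinTy.arrows (List.replicate n τ) A⟩ := by
  induction n generalizing Γ with
  | zero => exact h
  | succ n ih =>
    rw [Ctx.consN_succ'] at h
    exact (ih h).lam

/-! ### Finite types and one-hot data -/

/-- `E_n ≐ ∀α. α ⊸ ⋯ ⊸ α ⊸ α` (`n` arguments): the type of an `n`-valued datum; `tyB = tyE 2`.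
[cite: GaboardiMarionRonchidellarocca2008, §3.2 (B ≐ ∀α.α ⊸ α ⊸ α)] -/
def tyE (n : ℕ) : LinTy := .all (LinTy.arrows (List.replicate n ⟨0, .tvar 0⟩) (.tvar 0))

/-- `B = E₂`. [cite: GaboardiMarionRonchidellarocca2008, §3.2] -/
theorem tyB_eq_tyE : tyB = tyE 2 := rfl

/-- `oneHot n i ≐ λx₀…xₙ₋₁. xᵢ`, the `i`-th element of `E_n`; `0 = oneHot 2 0`, `1 = oneHot 2 1`.
[cite: GaboardiMarionRonchidellarocca2008, §3.2] -/
def oneHot (n i : ℕ) : Term := Term.lams n (.var (n - 1 - i))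

/-- `zero_eq_oneHot` (bookkeeping). [folklore] -/
theorem zero_eq_oneHot : STA.zero = oneHot 2 0 := rfl
/-- `one_eq_oneHot` (bookkeeping). [folklore] -/
theorem one_eq_oneHot : STA.one = oneHot 2 1 := rfl

/-- `oneHot n i` is sum-free. [folklore] -/
theorem sumFree_oneHot (n i : ℕ) : (oneHot n i).SumFree :=
  (show (Term.var (n - 1 - i)).SumFree from trivial).lams n

/-- Substituting in arrows of replicated types. [folklore] -/
theorem LinTy.arrows_replicate_substp (n : ℕ) (τ : SoftTy) (A : LinTy) (θ : ℕ → LinTy) :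
    (LinTy.arrows (List.replicate n τ) A).substp θ = LinTy.arrows (List.replicate n (τ.substT θ)) (A.substp θ) := by
  induction n with
  | zero => rfl
  | succ n ih => simp [List.replicate_succ, LinTy.arrows, LinTy.substp, ih, SoftTy.substT]

/-- `E_n` instantiated: `E_n[C] = C ⊸ ⋯ ⊸ C ⊸ C`. [folklore] -/
theorem tyE_inst (n : ℕ) (C : LinTy) :
    (LinTy.arrows (List.replicate n ⟨0, .tvar 0⟩) (.tvar 0)).inst C = LinTy.arrows (List.replicate n ⟨0, C⟩) C := by
  rw [LinTy.inst_eq_substp, LinTy.arrows_replicate_substp]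
  rfl

/-- **`⊢ oneHot n i : E_n`** for `i < n`, in any empty context, ranks `0`, degree `0`
("data … typable … with degree 0"). [cite: GaboardiMarionRonchidellarocca2008, §3.2] -/
theorem HT.oneHot {r : ℕ} {n i : ℕ} (hi : i < n) : HT r Ctx.empty (oneHot n i) ⟨0, tyE n⟩ := by
  refine HT.allI (HT.lams n ?_)
  -- the body: the variable `n-1-i` in the context of the `n` bound variables
  refine (HT.var (Γ := fun j => if j = n - 1 - i then some ⟨0, .tvar 0⟩ else none) ⟨by simp, fun j hj => by simp [hj]⟩).extend
    (fun j hj => ?_) (n := n) (fun j hj => by simp [Ctx.consN, show ¬(j < n) by omega, Ctx.empty])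
  by_cases h : j = n - 1 - i
  · subst h; simp [Ctx.consN, show n - 1 - i < n by omega]
  · simp [h] at hj

/-- **Case analysis on an `n`-valued datum with closed branches**: if `Γ ⊢ e : E_n` and
`⊢ Fⱼ : C` (closed, `j < n`) then `Γ ⊢ e F₀ ⋯ Fₙ₋₁ : C` — GMR08's `if x then M else N ≐ xMN`
generalised; sharing of resources between branches is obtained by choosing the `Fⱼ` closed and
`C` an arrow type. [cite: GaboardiMarionRonchidellarocca2008, §3.2] -/
theorem HT.caseE {r : ℕ} {Γ : Ctx} {e : Term} {n : ℕ} (C : LinTy) {Fs : List Term}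
    (he : HT r Γ e ⟨0, tyE n⟩) (hlen : Fs.length = n)
    (hF : ∀ j (hj : j < Fs.length), HT r Ctx.empty (Fs.get ⟨j, hj⟩) ⟨0, C⟩) : HT r Γ (e.apps Fs) ⟨0, C⟩ := by
  have h1 := he.allE C
  rw [tyE_inst] at h1
  exact HT.apps_closed h1 (by simp [hlen]) fun j hj => by simpa using hF j hj

/-! ### Reduction of case analysis -/

/-- Iterated lifting of a substitution at a variable. [folklore] -/
theorem Term.up_iterate_consSub (N : Term) (d k : ℕ) :
    (Term.up^[d] (Term.consSub N)) k =
      if k < d then .var k else if k = d then N.rename (fun i => i + d) else .var (k - 1) := by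
  induction d generalizing k with
  | zero =>
    cases k with
    | zero => simp [Term.rename_id']
    | succ k => simp
  | succ d ih =>
    rw [Function.iterate_succ_apply']
    cases k with
    | zero => simp [Term.up]
    | succ k =>
      rw [Term.up_succ, ih]
      by_cases h1 : k < d
      · simp [h1, show k + 1 < d + 1 by omega, Term.rename]
      · by_cases h2 : k = d
        · subst h2
          simp only [lt_irrefl, if_false, if_true, Term.rename_rename]
          exact Term.rename_congr (fun i => by show Nat.succ (i + k) = i + (k + 1); omega) _
        · have h3 : ¬(k + 1 < d + 1) := by omega
          have h4 : k + 1 ≠ d + 1 := by omega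
          simp only [h1, h2, h3, h4, if_false, Term.rename]
          congr 1
          omega

/-- Applying an abstraction whose body ignores the arguments: `(λx₁…xₘ. X↑ᵐ) G₁ ⋯ Gₘ →* X`.
[folklore] -/
theorem reduces_apps_lams_shift (m : ℕ) (X : Term) (Gs : List Term) (hlen : Gs.length = m) :
    Reduces ((Term.lams m (X.rename fun i => i + m)).apps Gs) X := by
  induction m generalizing Gs X with
  | zero =>
    cases Gs with
    | nil => simp [Term.lams, Term.rename_id']; exact Relation.ReflTransGen.refl
    | cons _ _ => simp at hlen
  | succ m ih =>
    cases Gs with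
    | nil => simp at hlen
    | cons G Gs =>
      simp only [List.length_cons, Nat.add_right_cancel_iff] at hlen
      simp only [Term.lams, Term.apps_cons]
      -- the first β-step
      have hβ : Red (Term.app (.lam (Term.lams m (X.rename fun i => i + (m + 1)))) G)
          (Term.lams m (X.rename fun i => i + m)) := by
        have := Red.beta (Term.lams m (X.rename fun i => i + (m + 1))) G
        rw [Term.subst0_eq_substp, Term.substp_lams, Term.substp_rename] at this
        convert this using 2
        rw [Term.rename_eq_substp]
        refine Term.substp_congr (fun i => ?_) _
        simp only [Function.comp_apply, Term.up_iterate_consSub]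
        rw [if_neg (by omega), if_neg (by omega)]
        exact congrArg Term.var (by omega)
      exact (Reduces.apps (Relation.ReflTransGen.single hβ) Gs).trans (ih X Gs hlen)

/-- **`oneHot n i F₀ ⋯ Fₙ₋₁ →* Fᵢ`.** [cite: GaboardiMarionRonchidellarocca2008, §3.2] -/
theorem reduces_apps_oneHot {n i : ℕ} (hi : i < n) (Fs : List Term) (hlen : Fs.length = n) :
    Reduces ((oneHot n i).apps Fs) (Fs.get ⟨i, hlen ▸ hi⟩) := by
  induction n generalizing i Fs with
  | zero => omega
  | succ n ih =>
    cases Fs with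
    | nil => simp at hlen
    | cons F Fs =>
      simp only [List.length_cons, Nat.add_right_cancel_iff] at hlen
      simp only [oneHot, Term.lams, Term.apps_cons]
      cases i with
      | zero =>
        -- the selected branch: `(λx₁…xₙ. F↑ⁿ) F₁ ⋯ Fₙ →* F`
        have hβ : Red (Term.app (.lam (Term.lams n (.var (n + 1 - 1 - 0)))) F) (Term.lams n (F.rename fun j => j + n)) := by
          have := Red.beta (Term.lams n (.var (n + 1 - 1 - 0))) F
          rw [Term.subst0_eq_substp, Term.substp_lams] at this
          convert this using 2
          simp only [Term.substp, Term.up_iterate_consSub]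
          rw [if_neg (by omega), if_pos (by omega)]
        exact (Reduces.apps (Relation.ReflTransGen.single hβ) Fs).trans (reduces_apps_lams_shift n F Fs hlen)
      | succ i =>
        -- a discarded branch: `(λx₀…xₙ. xᵢ₊₁) F →β λx₁…xₙ. xᵢ`
        have hβ : Red (Term.app (.lam (Term.lams n (.var (n + 1 - 1 - (i + 1))))) F) (oneHot n i) := by
          have := Red.beta (Term.lams n (.var (n + 1 - 1 - (i + 1)))) F
          rw [Term.subst0_eq_substp, Term.substp_lams] at this
          convert this using 2
          simp only [oneHot, Term.substp, Term.up_iterate_consSub]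
          rw [if_pos (by omega)]
          congr 2; omega
        exact (Reduces.apps (Relation.ReflTransGen.single hβ) Fs).trans (ih (by omega) Fs hlen)

end STA

end Literature.Computability.ImplicitComplexity
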